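import Mathlib
import Summits.Ventures.HodgeRepro.Tier4.Common.KTypeSpace
import Summits.Ventures.HodgeRepro.Tier4.Common.SettingOfData
import Summits.Ventures.HodgeRepro.Tier4.Line1.SpectralOfRTF
import Summits.Ventures.HodgeRepro.Tier4.Line4.W4SpectralBridge
import Summits.Ventures.HodgeRepro.Tier4.Line4.W3Reduction

/-!
# Tier4/Line4/W3Reduction2 — the wall W3″ of LINE L4 from displayed spectral data, REPAIRED (plan-4 (R), S13554):
blocks indexed by CONSTITUENT, vanishing only WITHIN each constituent (no finite-rank device)

Blind re-derivation cell `pub-hodge-repro`, Tier 4 (README §9–§10), seat t4-L1-p5 (prover, LINE L1, gen 2).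
FINDING F-L4-hvan (t4-plan-4 g2 S13554, conceded S13558): `W3Reduction`'s `hvan` — `R(f̄₁)` kills every basis vector
outside FINITELY many blocks of a COMPLETE orthonormal basis of `L²(D_G)` — forces `R(f̄₁)` to have finite rank, which
no non-zero test function has on the genuine objects (Weyl's law + Paley–Wiener; plan-1's S12047 (vii) device); so
`W3Reduction`'s hypotheses (b)+(c) have no genuine instance.  THE REPAIR, on t4-L1-p1's `SpectralOfRTF` (p679406:
`specBlock m = ∑'_{n j = m} specTerm j`, `hasSum_specBlock`, `exists_specBlock_ne_zero` — the spectral expansion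
regrouped along the constituents `τ m`, an INFINITE sum): the blocks `F m` are the `(τ, K)`-type blocks of the
constituents (`hF : ∀ m, ∀ j ∈ F m, n j = m`), the vanishing `hvan'` is asked ONLY on the non-`(τ, K)` vectors of each
constituent (`j ∉ F (n j)` — satisfiable: a bi-`(τ, K)`-finite `f̄₁ = e ⋆ f ⋆ e` kills the orthogonal complement of
`L²^{τ,K}` and keeps compact support), the eigen-relations `ha`/`hb` hold per block, and `Jc(f₁ ⋆ f₂) ≠ 0` gives a
constituent `m` whose block is non-zero; the block is `b_m conj(a_m) · P_χ(v_m)` with `v_m` the Riesz vector of `P_{χ′}`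
on the conjugate block (`W4SpectralBridge` by name), whence W3″'s conclusion verbatim.  THE HONEST RESIDUAL after
this: (a) Harish-Chandra admissibility of every constituent + an ONB adapted to the `(τ, K)`-split (L4-p1's cut),
(b′) one scalar per `(τ, K)`-block, (c′) `Jc ≠ 0` for a bi-`(τ, K)`-finite pair — all DISPLAYED, none asserted.

Nothing here says anything about the status of the Hodge conjecture for CM abelian varieties, which is NOT proved
(HC_CM is NOT proved by anyone in this repository).
-/

set_option autoImplicit false

noncomputable section

namespace Summit.Ventures.HodgeRepro.Tier4.Line4

open Summit.Ventures.HodgeRepro.Tier4.Common Summit.Ventures.HodgeRepro.Tier4.Line1 MeasureTheory NumberField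
open scoped ComplexConjugate

section Reduction2

variable {k : Type} [Field k] [NumberField k] (W : PlaneData k) [MeasurableSpace (GA W)] [BorelSpace (GA W)]
  (R : RTFData W) (μ : Measure (GA W)) [μ.IsHaarMeasure] [R.μT.IsHaarMeasure] [R.μT'.IsHaarMeasure]
  (DG : Set (GA W)) (fdG : IsFundamentalDomain (rationalPoints W) DG μ) (compG : IsCompact (closure DG))
  (compT : IsCompact (closure R.DT)) (compT' : IsCompact (closure R.DT'))

/-- **a `(τ, K)`-block in Riesz form**: for continuous basis vectors `φ j`, `∑_{j ∈ F} P′_{χ′}(φ_j) conj P′_χ(φ_j)`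
(L1's periods, `χ′` conjugated inside) is `P_χ(v)` for `v = rieszOf F (conj ∘ φ) P_{χ′}` (typer-2's periods). -/
theorem block_eq_periodT_rieszOf (hc : Continuous R.chi) (hc' : Continuous R.chi')
    {τ : ℕ → Set (GA W → ℂ)} {φ : ℕ → GA W → ℂ} {n : ℕ → ℕ}
    (hB : (Setting.ofAdelicData W R μ DG fdG compG compT compT').IsAdaptedONB τ φ n) (F : Finset ℕ) :
    ∑ j ∈ F, (Setting.ofAdelicData W R μ DG fdG compG compT compT').periodT' R.chi'
        (fun t' => φ j t') *
      conj ((Setting.ofAdelicData W R μ DG fdG compG compT compT').periodT R.chi (fun t => φ j t)) =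
    R.periodT (restrictTo W (torusT W)
      (RTF.Setting.rieszOf F (fun l x => conj (φ l x)) (periodT'Fun W R))) := by
  haveI : IsFiniteMeasureOnCompacts R.μT' := (inferInstance : R.μT'.IsHaarMeasure).toIsFiniteMeasureOnCompacts
  have hcont : ∀ l, Continuous (φ l) := fun l => (hB.inv (n l)).cont _ (hB.mem l)
  have hres : restrictTo W (torusT W) (RTF.Setting.rieszOf F (fun l x => conj (φ l x)) (periodT'Fun W R)) =
      ∑ j ∈ F, conj (periodT'Fun W R (fun x => conj (φ j x))) •
        restrictTo W (torusT W) (fun x => conj (φ j x)) := by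
    funext t
    simp only [RTF.Setting.rieszOf, restrictTo, Finset.sum_apply, Pi.smul_apply, smul_eq_mul]
  rw [hres, map_sum]
  refine Finset.sum_congr rfl fun j _ => ?_
  rw [map_smul, smul_eq_mul]
  have h1 : (Setting.ofAdelicData W R μ DG fdG compG compT compT').periodT' R.chi' (fun t' => φ j t') =
      R.periodT'conj (restrictTo W (torusT' W) (φ j)) :=
    periodT'_eq_periodT'conj W R μ DG fdG compG compT compT' hc' (hcont j)
  have h2 : conj ((Setting.ofAdelicData W R μ DG fdG compG compT compT').periodT R.chi (fun t => φ j t)) =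
      R.periodT (restrictTo W (torusT W) (fun x => conj (φ j x))) :=
    conj_periodT_eq W R μ DG fdG compG compT compT' hc (hcont j)
  rw [h1, h2]
  congr 1
  -- `conj (P_{χ′}(conj ∘ φ_j)) = P_{conj χ′}(φ_j)`
  have hint : Integrable (fun t : torusT' W => R.chi' t * restrictTo W (torusT' W) (fun x => conj (φ j x)) t)
      (R.μT'.restrict R.DT') := by
    refine integrableOn_of_continuous_of_isCompact_closure R.μT' compT' ?_
    exact hc'.mul (Complex.continuous_conj.comp ((hcont j).comp continuous_subtype_val))
  have hint' : Integrable (fun t : torusT' W => R.chi'conj t * restrictTo W (torusT' W) (φ j) t)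
      (R.μT'.restrict R.DT') := by
    refine integrableOn_of_continuous_of_isCompact_closure R.μT' compT' ?_
    exact (Complex.continuous_conj.comp hc').mul ((hcont j).comp continuous_subtype_val)
  rw [periodT'Fun, RTFData.periodT', periodLin_eq_integral W R.μT' R.DT' R.chi' hint, ← integral_conj,
    RTFData.periodT'conj, periodLin_eq_integral W R.μT' R.DT' R.chi'conj hint']
  refine integral_congr_ae (Filter.Eventually.of_forall fun t => ?_)
  simp only [restrictTo, RTFData.chi'conj, map_mul, Complex.conj_conj]

/-- **the `m`-block of the spectral expansion, evaluated** (plan-4 (R)): with the eigen-relations on the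
`(τ, K)`-block `F m` of the constituent `m` and the vanishing of `R(f̄₁)` on its other basis vectors,
`specBlock m = b_m conj(a_m) · P_χ(v_m)`. -/
theorem specBlock_eq (hc : Continuous R.chi) (hc' : Continuous R.chi')
    {τ : ℕ → Set (GA W → ℂ)} {φ : ℕ → GA W → ℂ} {n : ℕ → ℕ}
    (hB : (Setting.ofAdelicData W R μ DG fdG compG compT compT').IsAdaptedONB τ φ n)
    {f₁ f₂ : GA W → ℂ} (F : ℕ → Finset ℕ) (hF : ∀ m, ∀ j ∈ F m, n j = m) (a b : ℕ → ℂ)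
    (ha : ∀ m, ∀ j ∈ F m, rightRegular W μ (RTF.cj f₁) (φ j) = fun x => a m * φ j x)
    (hb : ∀ m, ∀ j ∈ F m, rightRegular W μ (RTF.refl f₂) (φ j) = fun x => b m * φ j x)
    (hvan' : ∀ j, j ∉ F (n j) → rightRegular W μ (RTF.cj f₁) (φ j) = fun _ => 0) (m : ℕ) :
    RTF.Setting.specBlock (Setting.ofAdelicData W R μ DG fdG compG compT compT') R.chi R.chi' φ n f₁ f₂ m =
      b m * conj (a m) * R.periodT (restrictTo W (torusT W)
        (RTF.Setting.rieszOf (F m) (fun l x => conj (φ l x)) (periodT'Fun W R))) := by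
  classical
  set S := Setting.ofAdelicData W R μ DG fdG compG compT compT' with hS
  -- the terms of the fibre outside `F m` vanish
  have hterm0 : ∀ j : ↥(n ⁻¹' {m}), (j : ℕ) ∉ (F m) →
      RTF.Setting.specTerm S R.chi R.chi' φ f₁ f₂ j = 0 := by
    intro j hj
    have hnj : n j = m := j.2
    have hvj : rightRegular W μ (RTF.cj f₁) (φ j) = fun _ => 0 := hvan' j (by rw [hnj]; exact hj)
    unfold RTF.Setting.specTerm
    have hR : S.R (RTF.cj f₁) (φ j) = fun _ => 0 := hvj
    rw [hR]
    simp only [RTF.Setting.periodT_zero, map_zero, mul_zero]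
  have hsub : RTF.Setting.specBlock S R.chi R.chi' φ n f₁ f₂ m =
      ∑ j ∈ (F m).subtype (fun j => j ∈ n ⁻¹' {m}), RTF.Setting.specTerm S R.chi R.chi' φ f₁ f₂ j := by
    unfold RTF.Setting.specBlock
    refine tsum_eq_sum fun j hj => hterm0 j ?_
    intro hmem
    exact hj (Finset.mem_subtype.mpr hmem)
  rw [hsub, Finset.sum_subtype_eq_sum_filter, Finset.filter_true_of_mem (fun j hj => ?_)]
  · rw [← block_eq_periodT_rieszOf W R μ DG fdG compG compT compT' hc hc' hB (F m), Finset.mul_sum]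
    refine Finset.sum_congr rfl fun j hj => ?_
    unfold RTF.Setting.specTerm
    have hRa : S.R (RTF.cj f₁) (φ j) = fun x => a m * φ j x := ha m j hj
    have hRb : S.R (RTF.refl f₂) (φ j) = fun x => b m * φ j x := hb m j hj
    rw [hRa, hRb]
    simp only []
    rw [RTF.Setting.periodT'_const_mul, RTF.Setting.periodT_const_mul, map_mul]
    ring
  · show n j ∈ ({m} : Set ℕ)
    rw [Set.mem_singleton_iff]
    exact hF m j hj

/-- **W3″ FROM DISPLAYED SPECTRAL DATA, REPAIRED** (plan-4 (R)): constituents `V m` (all admissible), a level `K`, an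
adapted orthonormal basis `φ` with `(τ, K)`-blocks `F m ⊆ n⁻¹'{m}` whose conjugate blocks span the `K`-type spaces,
the eigen-relations per block, the vanishing of `R(f̄₁)` on the other basis vectors OF EACH CONSTITUENT, and
`Jc(f₁ ⋆ f₂) ≠ 0` — then some `V m` carries, on its `K`-type space, a Riesz vector of the `T′`-period with a non-zero
`T`-period: the conclusion of the wall `mixed_two_torus_W3` verbatim over a generic plane. -/
theorem mixed_two_torus_W3_of_spectral_data' (hc : Continuous R.chi) (hu : ∀ a, ‖R.chi a‖ = 1)
    (hc' : Continuous R.chi') (hunit' : ∀ t, ‖R.chi' t‖ = 1)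
    (q : QuadData k) (g g' : Matrix (Fin 4) (Fin 4) k) (w₀ : InfinitePlace k)
    (eP eM eP' eM' : InfinitePlace k → ℤ) (V : ℕ → Submodule ℂ (GA W → ℂ))
    (hadm : ∀ m, IsAdmissibleS W (Setting.ofAdelicData W R μ DG fdG compG compT compT') q g g' w₀ eP eM eP' eM'
      (V m))
    (K : Subgroup (GA W)) (hK : IsCompactOpenIn W (finitePart W) K)
    {τ : ℕ → Set (GA W → ℂ)} {φ : ℕ → GA W → ℂ} {n : ℕ → ℕ}
    (hB : (Setting.ofAdelicData W R μ DG fdG compG compT compT').IsAdaptedONB τ φ n)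
    (_hτ : ∀ m, (V m : Set (GA W → ℂ)) = τ m)
    (F : ℕ → Finset ℕ) (hF : ∀ m, ∀ j ∈ F m, n j = m)
    (hspan : ∀ m, Submodule.span ℂ ((fun j => fun x => conj (φ j x)) '' (F m : Set ℕ)) =
      kTypeSpace W q g g' eP eM eP' eM' K (V m))
    {f₁ f₂ : GA W → ℂ} (h₁ : IsTestFn W f₁) (h₂ : IsTestFn W f₂) (a b : ℕ → ℂ)
    (ha : ∀ m, ∀ j ∈ F m, rightRegular W μ (RTF.cj f₁) (φ j) = fun x => a m * φ j x)
    (hb : ∀ m, ∀ j ∈ F m, rightRegular W μ (RTF.refl f₂) (φ j) = fun x => b m * φ j x)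
    (hvan' : ∀ j, j ∉ F (n j) → rightRegular W μ (RTF.cj f₁) (φ j) = fun _ => 0)
    (hJ : R.Jc ((Setting.ofAdelicData W R μ DG fdG compG compT compT').conv f₁ f₂) ≠ 0) :
    ∃ V₀ : Submodule ℂ (GA W → ℂ),
      IsAdmissibleS W (Setting.ofAdelicData W R μ DG fdG compG compT compT') q g g' w₀ eP eM eP' eM' V₀ ∧
      ∃ K₀ : Subgroup (GA W), IsCompactOpenIn W (finitePart W) K₀ ∧
        FiniteDimensional ℂ (kTypeSpace W q g g' eP eM eP' eM' K₀ V₀) ∧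
        ∃ f : GA W → ℂ, IsRieszVectorOn R μ DG (kTypeSpace W q g g' eP eM eP' eM' K₀ V₀) f ∧
          periodLin W R.μT R.DT R.chi (restrictTo W (torusT W) f) ≠ 0 := by
  set S := Setting.ofAdelicData W R μ DG fdG compG compT compT' with hS
  haveI := t2Space_GA W
  have h₁' : RTF.IsTest f₁ := ⟨h₁.1, h₁.2⟩
  have h₂' : RTF.IsTest f₂ := ⟨h₂.1, h₂.2⟩
  have hconv : IsTestFn W (S.conv f₁ f₂) :=
    ⟨(S.conv_isTest h₁' h₂').1.cont, (S.conv_isTest h₁' h₂').1.compact⟩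
  have hJ' : S.J R.chi R.chi' (S.conv f₁ f₂) ≠ 0 := by
    rw [← Jc_eq_J W R μ DG fdG compG compT compT' hc hc' hconv]
    exact hJ
  obtain ⟨m, hm⟩ := S.exists_specBlock_ne_zero R.chi R.chi' φ n f₁ f₂
    (isCharacter_chi W R μ DG fdG compG compT compT' hc hu)
    (isCharacter'_chi' W R μ DG fdG compG compT compT' hc' hunit') hB h₁' h₂' hJ'
  rw [specBlock_eq W R μ DG fdG compG compT compT' hc hc' hB F hF a b ha hb hvan' m] at hm
  have hP : R.periodT (restrictTo W (torusT W)
      (RTF.Setting.rieszOf (F m) (fun l x => conj (φ l x)) (periodT'Fun W R))) ≠ 0 :=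
    (mul_ne_zero_iff.mp hm).2
  have hne := exists_period_ne_zero_of_rieszOf_period_ne_zero W R (F m) φ hP
  refine ⟨V m, hadm m, K, hK, ?_, RTF.Setting.rieszOf (F m) (fun l x => conj (φ l x)) (periodT'Fun W R), ?_, ?_⟩
  · rw [← hspan m]
    exact FiniteDimensional.span_of_finite ℂ ((F m).finite_toSet.image _)
  · exact isRieszVectorOn_rieszOf W R μ DG fdG compG compT compT' hB (F m) _ (hspan m).symm hne
  · exact hP

/-- **W3″ FROM DISPLAYED SPECTRAL DATA, REPAIRED TWICE** (t4-L4-p1 g3's FINDING F-L4-hadm, S13597: `∀ m, IsAdmissibleS …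
(V m)` over EVERY index is unsatisfiable — the ONBs the tree builds have padded indices with `V m = ⊥`, and
`IsAdmissibleS ⊥` is false; and the unused `_hτ` forced every block-carrying constituent to be conjugation-closed).
The one-token repair: admissibility is asked ONLY of the constituents on which `R(f̄₁)` acts by a NON-ZERO scalar
(`hadm : ∀ m, a m ≠ 0 → IsAdmissibleS … (V m)` — the admissible-projector content of the isolation, per constituent,
satisfiable by a `(τ, K)`-finite `f̄₁` whose Hecke part kills the non-lowest / non-cuspidal constituents of the same
`(τ, K)`-type), and no `_hτ`.  Same proof: the block found has `b m · conj (a m) ≠ 0`, hence `a m ≠ 0`. -/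
theorem mixed_two_torus_W3_of_spectral_data'' (hc : Continuous R.chi) (hu : ∀ a, ‖R.chi a‖ = 1)
    (hc' : Continuous R.chi') (hunit' : ∀ t, ‖R.chi' t‖ = 1)
    (q : QuadData k) (g g' : Matrix (Fin 4) (Fin 4) k) (w₀ : InfinitePlace k)
    (eP eM eP' eM' : InfinitePlace k → ℤ) (V : ℕ → Submodule ℂ (GA W → ℂ))
    (K : Subgroup (GA W)) (hK : IsCompactOpenIn W (finitePart W) K)
    {τ : ℕ → Set (GA W → ℂ)} {φ : ℕ → GA W → ℂ} {n : ℕ → ℕ}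
    (hB : (Setting.ofAdelicData W R μ DG fdG compG compT compT').IsAdaptedONB τ φ n)
    (F : ℕ → Finset ℕ) (hF : ∀ m, ∀ j ∈ F m, n j = m)
    (hspan : ∀ m, Submodule.span ℂ ((fun j => fun x => conj (φ j x)) '' (F m : Set ℕ)) =
      kTypeSpace W q g g' eP eM eP' eM' K (V m))
    {f₁ f₂ : GA W → ℂ} (h₁ : IsTestFn W f₁) (h₂ : IsTestFn W f₂) (a b : ℕ → ℂ)
    (hadm : ∀ m, a m ≠ 0 →
      IsAdmissibleS W (Setting.ofAdelicData W R μ DG fdG compG compT compT') q g g' w₀ eP eM eP' eM' (V m))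
    (ha : ∀ m, ∀ j ∈ F m, rightRegular W μ (RTF.cj f₁) (φ j) = fun x => a m * φ j x)
    (hb : ∀ m, ∀ j ∈ F m, rightRegular W μ (RTF.refl f₂) (φ j) = fun x => b m * φ j x)
    (hvan' : ∀ j, j ∉ F (n j) → rightRegular W μ (RTF.cj f₁) (φ j) = fun _ => 0)
    (hJ : R.Jc ((Setting.ofAdelicData W R μ DG fdG compG compT compT').conv f₁ f₂) ≠ 0) :
    ∃ V₀ : Submodule ℂ (GA W → ℂ),
      IsAdmissibleS W (Setting.ofAdelicData W R μ DG fdG compG compT compT') q g g' w₀ eP eM eP' eM' V₀ ∧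
      ∃ K₀ : Subgroup (GA W), IsCompactOpenIn W (finitePart W) K₀ ∧
        FiniteDimensional ℂ (kTypeSpace W q g g' eP eM eP' eM' K₀ V₀) ∧
        ∃ f : GA W → ℂ, IsRieszVectorOn R μ DG (kTypeSpace W q g g' eP eM eP' eM' K₀ V₀) f ∧
          periodLin W R.μT R.DT R.chi (restrictTo W (torusT W) f) ≠ 0 := by
  set S := Setting.ofAdelicData W R μ DG fdG compG compT compT' with hS
  haveI := t2Space_GA W
  have h₁' : RTF.IsTest f₁ := ⟨h₁.1, h₁.2⟩
  have h₂' : RTF.IsTest f₂ := ⟨h₂.1, h₂.2⟩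
  have hconv : IsTestFn W (S.conv f₁ f₂) :=
    ⟨(S.conv_isTest h₁' h₂').1.cont, (S.conv_isTest h₁' h₂').1.compact⟩
  have hJ' : S.J R.chi R.chi' (S.conv f₁ f₂) ≠ 0 := by
    rw [← Jc_eq_J W R μ DG fdG compG compT compT' hc hc' hconv]
    exact hJ
  obtain ⟨m, hm⟩ := S.exists_specBlock_ne_zero R.chi R.chi' φ n f₁ f₂
    (isCharacter_chi W R μ DG fdG compG compT compT' hc hu)
    (isCharacter'_chi' W R μ DG fdG compG compT compT' hc' hunit') hB h₁' h₂' hJ'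
  rw [specBlock_eq W R μ DG fdG compG compT compT' hc hc' hB F hF a b ha hb hvan' m] at hm
  have ha0 : a m ≠ 0 := by
    intro h0
    apply hm
    rw [h0, map_zero, mul_zero, zero_mul]
  have hP : R.periodT (restrictTo W (torusT W)
      (RTF.Setting.rieszOf (F m) (fun l x => conj (φ l x)) (periodT'Fun W R))) ≠ 0 :=
    (mul_ne_zero_iff.mp hm).2
  have hne := exists_period_ne_zero_of_rieszOf_period_ne_zero W R (F m) φ hP
  refine ⟨V m, hadm m ha0, K, hK, ?_, RTF.Setting.rieszOf (F m) (fun l x => conj (φ l x)) (periodT'Fun W R),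
    ?_, ?_⟩
  · rw [← hspan m]
    exact FiniteDimensional.span_of_finite ℂ ((F m).finite_toSet.image _)
  · exact isRieszVectorOn_rieszOf W R μ DG fdG compG compT compT' hB (F m) _ (hspan m).symm hne
  · exact hP

end Reduction2

end Summit.Ventures.HodgeRepro.Tier4.Line4

end
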